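import Literature.MathematicalPhysics.QuantumFieldTheory.Balaban1983to89.Node00.TorusCoverLandau153TestForm
import Literature.MathematicalPhysics.QuantumFieldTheory.Balaban1983to89.Node00.TorusCoverLevels

/-!
# NODE 00 — [Balaban1985Variational] (153) AT THE RECORD'S TORUS FOR EVERY `μ ∈ N(Q′_D)`: the test-function form of `Node00.TorusCoverLandau153TestForm` with its three
# displayed rows supplied from lit-balaban p21's `B6SectADomainsV1.Domains.InGauge D μ` ([Balaban1984PropagatorsII] (2.7) «λ = 0 on Λ₀, Q′_jλ = 0 on Λ_j») through
# dag-n07-e's level covers (`Node00.TorusCoverLevels`: `coverAt`, `rows153_h0_of_inGauge`, `rows153_hQ_of_inGauge`) and the one remaining SUPPORT row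

Cell `pub-ymgap`, width seat `pub-ymgap-dag-n07-w3` generation 2, INTENT-3 RE-KEYED (cell INBOX DEDUP-374 division with dag-n07-e g18, 2026-08-28).  EDITION v1.1 (generation 5,
2026-08-28; referee `pub-ymgap-dag-ref-L` READ-225 NIT-1): the stray `#print axioms` command at the end of the file removed — all declarations byte-identical.  NEW leaf, PROOF kind (no `def`,
no `instance`, no `notation`).  CONSUMED BY NAME, nothing modified: this seat's FILE 1 `Node00.TorusCoverLandau153TestForm` (`sum_laplace_mul_diverg_re∕im_eq_zero_of_isLandau138_cover`,
`box_subset_sq_zero`), dag-n07-e's module 38 `Node00.TorusCoverLevels` (`coverAt`, `rows153_h0_of_inGauge`, `rows153_hQ_of_inGauge`), lit-balaban p21's `B6SectADomainsV1` (`Domains`,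
`Deep`, `LamSite`, `InGauge`, `siteAvgIter_eq_zero_of_inGauge`), n05-c's `B8Eq191FlatLettersCubeMember.cubeFam_zero_finite`, N05's `B8Eq138LandauZd.IsLandau138`, `CubeB8`, r15's `cover`.
`--kind proof --supports stmt-QuantumFields-20542` (K1⁷; count-neutral).  [15] = [Balaban1985Variational]; [6] = [Balaban1985RegularSpaces]; [B6] = [Balaban1984PropagatorsII].

WHY.  FILE 1 proves [15] (153) ∕ [B6] (2.12) «`⟨Δμ, ∂*a⟩ = 0`» at the torus of record for test functions `μ` given by THREE DISPLAYED ROWS in cover letters (support two steps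
inside the window; zero on the lift of `Λ₀`; zero lifted block sums).  dag-n07-e's module 38 derives the second and third rows from `D.InGauge μ` for any nested family
`D : Domains P` under two STRUCTURAL rows relating `D` to the `ℤᵈ` tower (`D.LamSite 0 (cover P x)` on `X ∩ Λs 0`; `D.LamSite j (coverAt P j y)` and `blockSites (Lʲ) y ⊆ X`
on `Λs j`).  THIS FILE adds the first row (§1: `μ ∈ N(Q′_D)` vanishes off the fine sites of `Ω₁`, so its support lifts into any `S` covering them — structural row (C0)) and
composes (§2–§3): the (153) test form holds for EVERY `μ ∈ N(Q′_D)`, the rows now being properties of `D` alone, discharged once per family (for the (144) tower at the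
record: UST `FlatCubeSequenceAligned.cubeSeqM`, Summits side).

CONTENTS.  §1 `support_row_of_inGauge`.  §2 ★ `sum_laplace_mul_diverg_re_eq_zero_of_inGauge` ∕ `…_im_…` (generic `ℤᵈ` Landau datum `(L := P.L, m, η, Ω₀, Λs)`, window `X`).
§3 ★ `sum_laplace_mul_diverg_re_eq_zero_of_inGauge_window153` ∕ `…_im_…` (keyed on the sixth conjunct «`∃ A′`, `A ⟨π x, μ⟩ = A′ x μ` on `X′` ∧ `IsLandau138 L c.k η □₀ c.lamS 1 A′`»
of generation 0's one-window theorems and of this seat's two-window theorem, any `X′ ⊆ □₀`).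

HONEST FRAMING: compositions by name; the structural rows (C0) `∀ y, D.Deep 0 y → y ∈ π '' S`, (C1) `∀ x ∈ X, x ∈ Λs 0 → D.LamSite 0 (π x)`, (Cj) `∀ j, 1 ≤ j ≤ m, ∀ y ∈ Λs j,
D.LamSite j (π_j y) ∧ blockSites (Lʲ) y ⊆ X` are DISPLAYED hypotheses (their discharge for the (144) pair `cubeSeqM` ↔ `CubeB8` is a separate geometry item, Summits side); the last
inch to `B6SectAOperatorsV1.RE D c (dsE c a) = 0` is `RE_eq_zero_iff` + `inner_eq_sum` (consumer's line); nothing of [15] ∕ [6] ∕ [B6] analysis asserted; [6] Proposition 6 at the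
member remains the hypothesis of generation 0's theorems; N07 ∕ N05 ∕ K0⁷ ∕ K1⁷ NOT closed or discharged; counts unmoved (typed 28∕28 · discharged 5∕27); one finite 𝕋⁴ programme at
fixed ε — R4 closes the conditional finite-𝕋⁴ rung `BalabanLadder.UV` only; the YM mass gap (Clay) is NOT proved by any of this; nothing continuum ∕ ℝ⁴ ∕ infinite volume ∕ OS.
No `sorry`, no `def`, no `instance`, no `notation`.
-/

noncomputable section

namespace Literature.MathematicalPhysics.QuantumFieldTheory.Balaban1983to89.Node00

open scoped Matrix.Norms.L2Operator
open B8Eq138LandauZd (IsLandau138)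
open B8Eq131Cubes (box)
open B8Eq191FlatLettersCubeMember (cubeFam_zero_finite)
open B15Eq112TorusCover (cover)
open B14DomainGeom (Pt)
open LatticeFieldCalculus (laplace diverg)
open Literature.MathematicalPhysics.QuantumLattice (blockSites)
open B6SectADomainsV1 (Domains)

variable {P : Params}

/-! ## §1  The support row: `μ ∈ N(Q′_D)` lives on the fine sites of `Ω₁` -/

/-- **ROW (C0) ⇒ THE SUPPORT ROW**: a gauge test function `μ ∈ N(Q′_D)` ([B6] (2.7): «`λ = 0` on `Λ₀ = Ω₁ᶜ`») vanishes at every fine site NOT inside `Ω₁` (`¬ D.Deep 0 y`), so if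
every fine site inside `Ω₁` is the cover of a point of `S ⊆ ℤᵈ`, then `μ` is supported on `π(S)` — the row `hμS` of `Node00.TorusCoverLandau153TestForm`.
[cite: Balaban1984PropagatorsII, (2.3) p.224, (2.7) p.224, (2.10) p.225] -/
theorem support_row_of_inGauge (D : Domains P) {μ : SiteField P 0 ℝ} (hμ : D.InGauge μ) {S : Set (Pt P.d)}
    (hC0 : ∀ y : Site P 0, D.Deep 0 y → y ∈ cover P '' S) : ∀ y, μ y ≠ 0 → y ∈ cover P '' S := by
  intro y hy
  refine hC0 y ?_
  by_contra h
  exact hy (D.siteAvgIter_eq_zero_of_inGauge hμ 0 y h)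

/-! ## §2  ★ (153) test form for every `μ ∈ N(Q′_D)` — generic Landau datum -/

section Generic

variable {𝔸 : Type*} [NormedRing 𝔸] [NormedAlgebra ℂ 𝔸] [CompleteSpace 𝔸]

/-- ★ **[15] (153) ∕ [B6] (2.12) AT THE RECORD'S TORUS FOR EVERY `μ ∈ N(Q′_D)`, REAL PART.**  Setting of FILE 1 §3: `IsLandau138 P.L m η Ω₀ Λs 1 A′` on `ℤᵈ` (N05's multiplier form,
flat background), a window `X ⊆ Ω₀` on which `π` is injective and the torus potential `A` is the push-forward of `A′`, a set `S` two steps inside `X`.  Let `D : Domains P` be a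
nested family ([B6] (2.1)–(2.4)) tied to `(Λs, X, S)` by the structural rows (C0) every fine site inside `Ω₁` is the cover of a point of `S`; (C1) on `X ∩ Λs 0` the cover lies in
`Λ₀`; (Cj) for `1 ≤ j ≤ m`, `y ∈ Λs j`: `π_j y ∈ Λ_j` and `blockSites (Lʲ) y ⊆ X`.  Then for EVERY `μ` with `D.InGauge μ` and every `φ : 𝔸 →L[ℂ] ℂ`:
`Σ_y (laplace η⁻¹ μ)(y)·(diverg η⁻¹ (Re(φ∘A)))(y) = 0` — `⟨Δμ, ∂*a⟩ = 0`, `a = Re(φ∘A)`, the test-function reading of `R ∂*a = 0` (`B6SectAOperatorsV1.RE_eq_zero_iff`).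
[cite: Balaban1985Variational, (153) p.301, p.302; Balaban1985RegularSpaces, (1.38) p.82; Balaban1984PropagatorsII, (2.7) p.224, (2.10)–(2.12) p.225] -/
theorem sum_laplace_mul_diverg_re_eq_zero_of_inGauge {m : ℕ} {η : ℝ} {Ω₀ : Set (Pt P.d)} (hΩ : Ω₀.Finite)
    {Λs : ℕ → Set (Pt P.d)} {A' : Pt P.d → Fin P.d → 𝔸}
    (hLan : IsLandau138 P.L m η Ω₀ Λs (1 : B7Prop1Explicit.Site P.d → Fin P.d → 𝔸ˣ) A')
    {X : Set (Pt P.d)} (hXΩ : X ⊆ Ω₀) (hinj : Set.InjOn (cover P) X)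
    {A : PBond P 0 → 𝔸} (hA : ∀ z, z ∈ X → ∀ κ, A ⟨cover P z, κ⟩ = A' z κ)
    {S : Set (Pt P.d)} (hS : ∀ s ∈ S, ∀ z : Pt P.d, (∀ i, |z i - s i| ≤ 2) → z ∈ X)
    (D : Domains P) (hC0 : ∀ y : Site P 0, D.Deep 0 y → y ∈ cover P '' S)
    (hC1 : ∀ x ∈ X, x ∈ Λs 0 → D.LamSite 0 (cover P x))
    (hCj : ∀ j, 1 ≤ j → j ≤ m → ∀ y ∈ Λs j, D.LamSite j (coverAt P j y) ∧ (↑(blockSites (P.L ^ j) y) : Set (Pt P.d)) ⊆ X)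
    {μ : SiteField P 0 ℝ} (hμ : D.InGauge μ) (φ : 𝔸 →L[ℂ] ℂ) :
    ∑ y : Site P 0, laplace η⁻¹ μ y * diverg η⁻¹ (fun b => (φ (A b)).re) y = 0 :=
  sum_laplace_mul_diverg_re_eq_zero_of_isLandau138_cover P.L_pos hΩ hLan hXΩ hinj hA (support_row_of_inGauge D hμ hC0) hS
    (rows153_h0_of_inGauge D hμ hC1) (rows153_hQ_of_inGauge D hμ hCj) φ

/-- ★ **The same, IMAGINARY PART** (`a = Im(φ∘A)`). [cite: Balaban1985Variational, (153) p.301; Balaban1984PropagatorsII, (2.7) p.224, (2.12) p.225] -/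
theorem sum_laplace_mul_diverg_im_eq_zero_of_inGauge {m : ℕ} {η : ℝ} {Ω₀ : Set (Pt P.d)} (hΩ : Ω₀.Finite)
    {Λs : ℕ → Set (Pt P.d)} {A' : Pt P.d → Fin P.d → 𝔸}
    (hLan : IsLandau138 P.L m η Ω₀ Λs (1 : B7Prop1Explicit.Site P.d → Fin P.d → 𝔸ˣ) A')
    {X : Set (Pt P.d)} (hXΩ : X ⊆ Ω₀) (hinj : Set.InjOn (cover P) X)
    {A : PBond P 0 → 𝔸} (hA : ∀ z, z ∈ X → ∀ κ, A ⟨cover P z, κ⟩ = A' z κ)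
    {S : Set (Pt P.d)} (hS : ∀ s ∈ S, ∀ z : Pt P.d, (∀ i, |z i - s i| ≤ 2) → z ∈ X)
    (D : Domains P) (hC0 : ∀ y : Site P 0, D.Deep 0 y → y ∈ cover P '' S)
    (hC1 : ∀ x ∈ X, x ∈ Λs 0 → D.LamSite 0 (cover P x))
    (hCj : ∀ j, 1 ≤ j → j ≤ m → ∀ y ∈ Λs j, D.LamSite j (coverAt P j y) ∧ (↑(blockSites (P.L ^ j) y) : Set (Pt P.d)) ⊆ X)
    {μ : SiteField P 0 ℝ} (hμ : D.InGauge μ) (φ : 𝔸 →L[ℂ] ℂ) :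
    ∑ y : Site P 0, laplace η⁻¹ μ y * diverg η⁻¹ (fun b => (φ (A b)).im) y = 0 :=
  sum_laplace_mul_diverg_im_eq_zero_of_isLandau138_cover P.L_pos hΩ hLan hXΩ hinj hA (support_row_of_inGauge D hμ hC0) hS
    (rows153_h0_of_inGauge D hμ hC1) (rows153_hQ_of_inGauge D hμ hCj) φ

end Generic

/-! ## §3  ★ The datum form: keyed on the sixth conjunct of the push-down theorems at a `CubeB8` datum -/

section Datum

variable {N : ℕ}

/-- ★ **(153) FOR EVERY `μ ∈ N(Q′_D)` AT A `CubeB8` DATUM, REAL PART**: for a cover-injective window `X′ ⊆ □₀ = c.sq 0` and a torus potential `A : PBond P 0 → M_N(ℂ)` with the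
sixth conjunct «`∃ A′`, `A ⟨π x, μ⟩ = A′ x μ` on `X′` ∧ `IsLandau138 L c.k η □₀ c.lamS 1 A′`» of generation 0's `exists_localGauge152_153_window∕cube…` (one window, `X′ ⊆ box ⊆ □₀`
by `box_subset_sq_zero`) or of this seat's two-window `exists_localGauge152_153_window₂_of_gaugedBoundB8`, a nested family `D` tied to `(c.lamS, X′, S)` by (C0)(C1)(Cj),
every `μ ∈ N(Q′_D)` and every `φ : M_N(ℂ) →L[ℂ] ℂ`: `Σ_y (laplace η⁻¹ μ)(y)·(diverg η⁻¹ (Re(φ∘A)))(y) = 0`.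
[cite: Balaban1985Variational, (152)–(153) p.301; Balaban1985RegularSpaces, Prop. 6 (1.135)–(1.138) p.99, (1.131) p.99, (1.38) p.82; Balaban1984PropagatorsII, (2.7) p.224, (2.12) p.225] -/
theorem sum_laplace_mul_diverg_re_eq_zero_of_inGauge_window153 {K' : ℕ} {Ω' : ℕ → Set (B7Prop1Explicit.Site P.d)} (c : CubeB8 P.d P.L K' Ω')
    {η : ℝ} {X' : Set (Pt P.d)} (hX' : X' ⊆ c.sq 0) (hinj' : Set.InjOn (cover P) X')
    {A : PBond P 0 → MatA N}
    (h6 : ∃ A' : B7Prop1Explicit.Site P.d → Fin P.d → MatA N,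
        (∀ x, x ∈ X' → ∀ μ, A ⟨cover P x, μ⟩ = A' x μ) ∧
        IsLandau138 P.L c.k η (c.sq 0) c.lamS (1 : B7Prop1Explicit.Site P.d → Fin P.d → (MatA N)ˣ) A')
    {S : Set (Pt P.d)} (hS : ∀ s ∈ S, ∀ z : Pt P.d, (∀ i, |z i - s i| ≤ 2) → z ∈ X')
    (D : Domains P) (hC0 : ∀ y : Site P 0, D.Deep 0 y → y ∈ cover P '' S)
    (hC1 : ∀ x ∈ X', x ∈ c.lamS 0 → D.LamSite 0 (cover P x))
    (hCj : ∀ j, 1 ≤ j → j ≤ c.k → ∀ y ∈ c.lamS j, D.LamSite j (coverAt P j y) ∧ (↑(blockSites (P.L ^ j) y) : Set (Pt P.d)) ⊆ X')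
    {μ : SiteField P 0 ℝ} (hμ : D.InGauge μ) (φ : MatA N →L[ℂ] ℂ) :
    ∑ y : Site P 0, laplace η⁻¹ μ y * diverg η⁻¹ (fun b => (φ (A b)).re) y = 0 := by
  obtain ⟨A', hA, hLan⟩ := h6
  exact sum_laplace_mul_diverg_re_eq_zero_of_inGauge (cubeFam_zero_finite P.L c.a c.M c.ρ c.k) hLan hX' hinj' hA hS D hC0 hC1 hCj hμ φ

/-- ★ **The same, IMAGINARY PART.** [cite: Balaban1985Variational, (153) p.301; Balaban1984PropagatorsII, (2.7) p.224, (2.12) p.225] -/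
theorem sum_laplace_mul_diverg_im_eq_zero_of_inGauge_window153 {K' : ℕ} {Ω' : ℕ → Set (B7Prop1Explicit.Site P.d)} (c : CubeB8 P.d P.L K' Ω')
    {η : ℝ} {X' : Set (Pt P.d)} (hX' : X' ⊆ c.sq 0) (hinj' : Set.InjOn (cover P) X')
    {A : PBond P 0 → MatA N}
    (h6 : ∃ A' : B7Prop1Explicit.Site P.d → Fin P.d → MatA N,
        (∀ x, x ∈ X' → ∀ μ, A ⟨cover P x, μ⟩ = A' x μ) ∧
        IsLandau138 P.L c.k η (c.sq 0) c.lamS (1 : B7Prop1Explicit.Site P.d → Fin P.d → (MatA N)ˣ) A')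
    {S : Set (Pt P.d)} (hS : ∀ s ∈ S, ∀ z : Pt P.d, (∀ i, |z i - s i| ≤ 2) → z ∈ X')
    (D : Domains P) (hC0 : ∀ y : Site P 0, D.Deep 0 y → y ∈ cover P '' S)
    (hC1 : ∀ x ∈ X', x ∈ c.lamS 0 → D.LamSite 0 (cover P x))
    (hCj : ∀ j, 1 ≤ j → j ≤ c.k → ∀ y ∈ c.lamS j, D.LamSite j (coverAt P j y) ∧ (↑(blockSites (P.L ^ j) y) : Set (Pt P.d)) ⊆ X')
    {μ : SiteField P 0 ℝ} (hμ : D.InGauge μ) (φ : MatA N →L[ℂ] ℂ) :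
    ∑ y : Site P 0, laplace η⁻¹ μ y * diverg η⁻¹ (fun b => (φ (A b)).im) y = 0 := by
  obtain ⟨A', hA, hLan⟩ := h6
  exact sum_laplace_mul_diverg_im_eq_zero_of_inGauge (cubeFam_zero_finite P.L c.a c.M c.ρ c.k) hLan hX' hinj' hA hS D hC0 hC1 hCj hμ φ

end Datum

end Literature.MathematicalPhysics.QuantumFieldTheory.Balaban1983to89.Node00

end
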